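/-
Copyright (c) 2026. All rights reserved.
Released under Apache 2.0 license as described in the file LICENSE.
Authors: HodgeCM publication cell (pub/hodgecm-mathlib), Track B, seat K2E3-p25 (g0).
-/
import Summits.HodgeConjecture.HodgeConjecture.Theorems.K2E3GL3BruhatCellFunctionals      -- ★ E3β₃a (inducing character, cells s₁, s₂)
import Summits.HodgeConjecture.HodgeConjecture.Theorems.K2E3GL3BruhatCellHaar             -- ★ E3β₂ (coordinates, measures, retractions)
import Literature.NumberTheory.Automorphic.ParabolicGLExactProofs                          -- ★ `IsSmooth.twist_comp_leviProjection`
import Literature.NumberTheory.Automorphic.IrreducibleClasses                              -- ★ `IsSmooth.twist`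
import Literature.NumberTheory.Automorphic.SmoothIndClosedCellNonzero                      -- ★ `ParabolicTriple.rootDeltaChar_eq_one_of_mem_N`
import Literature.NumberTheory.Automorphic.UnipotentRadicalCompactOpenProofs               -- ★ `IsLimitOfCompactOpen.of_le`, `isClosed_unipotentRadicalGL`
import Literature.NumberTheory.Automorphic.GLnLeviOrbitalDescent                           -- ★ `isClosed_standardLeviGL`
import Summits.HodgeConjecture.HodgeConjecture.Theorems.K2E3GL3BorelModulus                -- ★ `rootDeltaChar_borel_three`
import HarnessLib

/-!
# K2_E3 road (h413), leaf (nsc-S-A′), brick E3β₃b — the two 3-cycle cells of `GL₃` contribute exactly a line each to `r_U(Ind_B^{GL₃} χδ^{1/2})`, with exponent `χ ∘ Ad(P_w)`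
Cell `pub/hodgecm-mathlib` (D-0151), Track B, seat K2E3-p25 (g0).  `--supports stmt-HodgeConjecture-24833 --as helper`; THEOREMS ONLY; COUNT-NEUTRAL.
For the inducing character `σ′ = (χ ∘ levi)·δ_B^{1/2}` of ★ `parabolicIndGL F id (𝟙.twist χ)` and a permutation `w ∈ S₃`, the hypotheses `hinv` (U-invariance of the Haar functional
`∫_{Γ_w} f(P_w γ)dγ` on `X^<_w`) and `hT` (torus equivariance with character `e_w = (χ ∘ levi ∘ Ad(P_w) ∘ diag)·(δ_B^{1/2} ∘ diag)` — the modulus of `γ ↦ diag⁻¹ γ diag` on `Γ_w` being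
EXACTLY `δ_B^{1/2}(diag)/δ_B^{1/2}(P_w diag P_w⁻¹)`, ★ `rootDeltaChar_borel_three`) of ★ E3γ2 are discharged from ★ E3β₁∕E3β₂; output per cell: a functional `Λ_w` on `J` with
`ker Λ_w ∩ F^<_w = F^≤_w`, `Λ_w ≠ 0` on `F^<_w`, and `Λ_w(r(m)x) = χ(levi(P_w diag(m) P_w⁻¹))·Λ_w(x)` — the exponent of cell `w` is `χ ∘ Ad(P_w)`, with NO modulus factor left.
HONEST LABEL: HC_CM is proved only modulo the 7 printed citations (2 remaining named inputs: hLiu418 = stmt-HodgeConjecture-24832, h413 = stmt-HodgeConjecture-24833) until rung 0 closes.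
## References
* [BernsteinZelevinsky1977] I. N. Bernstein, A. V. Zelevinsky, *Induced representations of reductive p-adic groups I*, Ann. Sci. ÉNS 10 (1977), 1.7–1.9, §2.3, Thm. 5.2.
* [Casselman1995] W. Casselman, *Introduction to the theory of admissible representations of p-adic reductive groups* (draft 1995), §1.5, §6.3 (Thm. 6.3.5).
-/

set_option autoImplicit false
set_option linter.dupNamespace false

noncomputable section

open Set Function MeasureTheory Measure Filter Representation
open scoped MatrixGroups NNReal ENNReal

namespace Summit.HodgeConjecture.HodgeConjecture.Cruxes.H413.K2E3GL3BruhatCellFunctionalsCycles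

open Literature.NumberTheory.Automorphic ValuativeRel
open Literature.NumberTheory.GaloisRepresentations Literature.NumberTheory.GaloisRepresentations.IsNonarchimedeanLocalField
open Summit.HodgeConjecture.HodgeConjecture.Cruxes.H413.K2E3GL3BorelUnipotentHaar
open Summit.HodgeConjecture.HodgeConjecture.Cruxes.H413.K2E3GL3BruhatCellSubgroups
open Summit.HodgeConjecture.HodgeConjecture.Cruxes.H413.K2E3GL3BruhatCellHaar
open Summit.HodgeConjecture.HodgeConjecture.Cruxes.H413.K2E3BorelCellJacquetLine
open Summit.HodgeConjecture.HodgeConjecture.Cruxes.H413.K2E3BorelCellCoinvariantsBound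
open Summit.HodgeConjecture.HodgeConjecture.Cruxes.H413.K2E3GL3BruhatCellFunctionals

variable {F : Type} [Field F] [ValuativeRel F] [TopologicalSpace F] [IsNonarchimedeanLocalField F]

/-! ## §2 Cell `s₁s₂ = (0→1→2→0)`: `Γ = U_{Q′} ≅ F × F` (normal in `U`), `S = U_{α₂}` -/

set_option maxHeartbeats 400000 in
/-- **Cell `cycle_one_two_zero` contributes exactly a line to `r_U(Ind_B χδ^{1/2})`, with exponent `χ ∘ Ad(P_w)`** (★ E3γ2 with the cell datum of ★ E3β₁; `Γ` is normal in `U`, the Haar measure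
`μ_F ⊗ μ_F` transported to `Γ` is invariant under the shears `γ ↦ s⁻¹γs` (`s ∈ S`), which gives `hinv`; `hT` by a diagonal scaling whose module is
`δ^{1/2}(diag)/δ^{1/2}(P diag P⁻¹)` (★ `rootDeltaChar_borel_three`)). [cite: BernsteinZelevinsky1977, Thm. 5.2] [cite: Casselman1995, §6.3, Thm. 6.3.5] -/
theorem exists_lineFunctional_cell_cycle_one_two_zero (χ : (Π a : Fin 3, GL {i : Fin 3 // (id : Fin 3 → Fin 3) i = a} F) →* ℂˣ) (hχ : IsOpen (χ.ker : Set (Π a : Fin 3, GL {i : Fin 3 // (id : Fin 3 → Fin 3) i = a} F))) :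
    let σ' := Representation.twist (((Representation.trivial ℂ (Π a : Fin 3, GL {i : Fin 3 // (id : Fin 3 → Fin 3) i = a} F) ℂ).twist χ).comp (leviProjection F (id : Fin 3 → Fin 3))) (rootDeltaChar (standardParabolicGL F (id : Fin 3 → Fin 3)))
    let I := smoothIndRep (standardParabolicGL F (id : Fin 3 → Fin 3)) σ'
    let mk := Coinvariants.mk (restrictUnipotentGL F (id : Fin 3 → Fin 3) I)
    let Flt := (vanishingOn (standardParabolicGL F (id : Fin 3 → Fin 3)) σ' (cellLT (K := F) (id : Fin 3 → Fin 3) (Equiv.swap (0 : Fin 3) 1 * Equiv.swap (1 : Fin 3) 2))).map mk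
    let Fle := (vanishingOn (standardParabolicGL F (id : Fin 3 → Fin 3)) σ' (cellLE (K := F) (id : Fin 3 → Fin 3) (Equiv.swap (0 : Fin 3) 1 * Equiv.swap (1 : Fin 3) 2))).map mk
    ∃ Λ : (restrictUnipotentGL F (id : Fin 3 → Fin 3) I).Coinvariants →ₗ[ℂ] ℂ,
      (∀ x ∈ Flt, Λ x = 0 ↔ x ∈ Fle) ∧ (∃ x ∈ Flt, Λ x ≠ 0) ∧
      ∀ (m : (Π a : Fin 3, GL {i : Fin 3 // (id : Fin 3 → Fin 3) i = a} F)), ∀ x ∈ Flt,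
        Λ (Representation.normalizedJacquetGL F (id : Fin 3 → Fin 3) I m x) =
          ((χ (leviProjection F (id : Fin 3 → Fin 3) ⟨(permGL (Equiv.swap (0 : Fin 3) 1 * Equiv.swap (1 : Fin 3) 2) : GL (Fin 3) F) * blockDiagonalGL F (id : Fin 3 → Fin 3) m * (permGL (Equiv.swap (0 : Fin 3) 1 * Equiv.swap (1 : Fin 3) 2) : GL (Fin 3) F)⁻¹, permGL_conj_blockDiagonalGL_mem_borel (Equiv.swap (0 : Fin 3) 1 * Equiv.swap (1 : Fin 3) 2) m⟩) : ℂˣ) : ℂ) * Λ x := by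
  intro σ' I mk Flt Fle
  haveI : T2Space F := (isLocalField F).toT2Space
  haveI : LocallyCompactSpace F := (isLocalField F).toLocallyCompactSpace
  haveI : SecondCountableTopology F := secondCountableTopology_localField F
  letI : MeasurableSpace F := borel F
  haveI : BorelSpace F := ⟨rfl⟩
  -- the cell datum (★ E3β₁) and the retraction (★ E3β₂)
  obtain ⟨hΓlow, hS, hSB, hdec⟩ := cellDatum_cycle_one_two_zero (F := F)
  have hΓU : unipotentRadicalGL F (![false, true, true] : Fin 3 → Bool) ≤ upperUnitriangular (Fin 3) F := (rootSubgroups_le (F := F)).2.1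
  have hSU : unipotentRadicalGL F (![false, false, true] : Fin 3 → Bool) ⊓ standardLeviGL F (![false, true, true] : Fin 3 → Bool) ≤ upperUnitriangular (Fin 3) F := (rootSubgroups_le (F := F)).2.2.2
  have hΓcl : IsClosed ((unipotentRadicalGL F (![false, true, true] : Fin 3 → Bool) : Subgroup (GL (Fin 3) F)) : Set (GL (Fin 3) F)) := isClosed_unipotentRadicalGL _
  have hΓlim : IsLimitOfCompactOpen ↥(unipotentRadicalGL F (![false, true, true] : Fin 3 → Bool)) := (isLimitOfCompactOpen_upperUnitriangular F 3).of_le hΓU hΓcl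
  obtain ⟨proj, hproj, hprojS⟩ := exists_proj_cycle_one_two_zero (F := F)
  -- coordinates (★ p11) and the transported Haar measure `μ_F ⊗ μ_F` on `Γ` (★ E3β₂)
  obtain ⟨e, he⟩ := exists_coordHomeomorph (R := F)
  obtain ⟨φ, hφ, hφadd⟩ := exists_homeomorph_unipotentRadicalGL_oneTwo e he
  letI : MeasurableSpace ↥(unipotentRadicalGL F (![false, true, true] : Fin 3 → Bool)) := borel _
  haveI : BorelSpace ↥(unipotentRadicalGL F (![false, true, true] : Fin 3 → Bool)) := ⟨rfl⟩
  obtain ⟨i1, i2, i3⟩ := measure_map_addHomeomorph φ hφadd (((Measure.addHaar : Measure F)).prod (Measure.addHaar : Measure F))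
  haveI := i1; haveI := i2; haveI := i3
  have hme : MeasurableEmbedding φ := φ.measurableEmbedding
  -- the torus character `e_w = (χ ∘ levi ∘ Ad P_w ∘ diag) · (δ^{1/2} ∘ diag)`
  let conjB : (Π a : Fin 3, GL {i : Fin 3 // (id : Fin 3 → Fin 3) i = a} F) →* ↥(standardParabolicGL F (id : Fin 3 → Fin 3)) :=
    ((MulAut.conj (permGL (Equiv.swap (0 : Fin 3) 1 * Equiv.swap (1 : Fin 3) 2) : GL (Fin 3) F)).toMonoidHom.comp (blockDiagonalGL F (id : Fin 3 → Fin 3))).codRestrict (standardParabolicGL F (id : Fin 3 → Fin 3))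
      (fun m => permGL_conj_blockDiagonalGL_mem_borel (Equiv.swap (0 : Fin 3) 1 * Equiv.swap (1 : Fin 3) 2) m)
  let ew : (Π a : Fin 3, GL {i : Fin 3 // (id : Fin 3 → Fin 3) i = a} F) →* ℂˣ := (χ.comp ((leviProjection F (id : Fin 3 → Fin 3)).comp conjB)) *
    (rootDeltaChar (standardParabolicGL F (id : Fin 3 → Fin 3))).comp (leviEmbeddingP F (id : Fin 3 → Fin 3))
  obtain ⟨Λ, hker, hne, hequiv⟩ := exists_lineFunctional_of_cellDatum σ' (Equiv.swap (0 : Fin 3) 1 * Equiv.swap (1 : Fin 3) 2) (unipotentRadicalGL F (![false, true, true] : Fin 3 → Bool)) (unipotentRadicalGL F (![false, false, true] : Fin 3 → Bool) ⊓ standardLeviGL F (![false, true, true] : Fin 3 → Bool)) (isSmooth_inducingChar χ hχ)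
    hΓU hΓcl hΓlim hΓlow hS hSB hdec proj hproj hprojS ((((Measure.addHaar : Measure F)).prod (Measure.addHaar : Measure F)).map φ)
    (by
      intro u hu f hf
      obtain ⟨s₀, hs₀, γ₀, hγ₀, rfl⟩ := hdec u hu
      -- `s₀` in coordinates
      obtain ⟨-, hz1, hz2⟩ := (mem_rootGroup_oneTwo_iff s₀).1 hs₀
      set a : F := (s₀ : Matrix (Fin 3) (Fin 3) F) 1 2 with ha
      have hs₀c : s₀ = ((e ((0, a), 0) : ↥(unipotentRadicalGL F (id : Fin 3 → Fin 3))) : GL (Fin 3) F) := by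
        conv_lhs => rw [eq_coord e he s₀ (hSU hs₀)]
        rw [hz1, hz2]
      have hB' := hSB _ hs₀
      have hU' : (permGL (Equiv.swap (0 : Fin 3) 1 * Equiv.swap (1 : Fin 3) 2) : GL (Fin 3) F) * s₀ * (permGL (Equiv.swap (0 : Fin 3) 1 * Equiv.swap (1 : Fin 3) 2) : GL (Fin 3) F)⁻¹ ∈ upperUnitriangular (Fin 3) F := permGL_conj_mem_upperUnitriangular _ (hSU hs₀) hB'
      have hfun : (fun γ : ↥(unipotentRadicalGL F (![false, true, true] : Fin 3 → Bool)) => (smoothIndRep (standardParabolicGL F (id : Fin 3 → Fin 3)) σ' (s₀ * γ₀) f).toFun ((permGL (Equiv.swap (0 : Fin 3) 1 * Equiv.swap (1 : Fin 3) 2) : GL (Fin 3) F) * ((γ : ↥(unipotentRadicalGL F (![false, true, true] : Fin 3 → Bool))) : GL (Fin 3) F))) =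
          fun γ => f.toFun ((permGL (Equiv.swap (0 : Fin 3) 1 * Equiv.swap (1 : Fin 3) 2) : GL (Fin 3) F) * ((s₀⁻¹ * ((γ : ↥(unipotentRadicalGL F (![false, true, true] : Fin 3 → Bool))) : GL (Fin 3) F) * s₀) * γ₀)) := by
        funext γ
        rw [toFun_smoothIndRep_apply]
        have hprod : (permGL (Equiv.swap (0 : Fin 3) 1 * Equiv.swap (1 : Fin 3) 2) : GL (Fin 3) F) * ((γ : ↥(unipotentRadicalGL F (![false, true, true] : Fin 3 → Bool))) : GL (Fin 3) F) * (s₀ * γ₀) = ((permGL (Equiv.swap (0 : Fin 3) 1 * Equiv.swap (1 : Fin 3) 2) : GL (Fin 3) F) * s₀ * (permGL (Equiv.swap (0 : Fin 3) 1 * Equiv.swap (1 : Fin 3) 2) : GL (Fin 3) F)⁻¹) * ((permGL (Equiv.swap (0 : Fin 3) 1 * Equiv.swap (1 : Fin 3) 2) : GL (Fin 3) F) * ((s₀⁻¹ * ((γ : ↥(unipotentRadicalGL F (![false, true, true] : Fin 3 → Bool))) : GL (Fin 3) F) * s₀) * γ₀)) := by group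
        rw [hprod]
        refine (SmoothInd.toFun_subgroup_mul f ⟨_, unipotentRadicalGL_le F (id : Fin 3 → Fin 3) hU'⟩ _).trans ?_
        exact inducingChar_apply_of_mem_upperUnitriangular χ hU' _
      rw [hfun, hme.integral_map, hme.integral_map]
      -- the shear `q ↦ φ⁻¹(s₀⁻¹ φ(q) s₀)` preserves `μ_F ⊗ μ_F`
      have hconj : ∀ q : F × F, s₀⁻¹ * ((φ q : ↥(unipotentRadicalGL F (![false, true, true] : Fin 3 → Bool))) : GL (Fin 3) F) * s₀ = ((φ ((q.1, q.2 + q.1 * a)) : ↥(unipotentRadicalGL F (![false, true, true] : Fin 3 → Bool))) : GL (Fin 3) F) := by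
        intro q
        rw [hφ, hφ, hs₀c, rootGroup_oneTwo_inv_mul_coord_mul e he]
      simp_rw [hconj]
      let sh : F × F ≃ₜ F × F :=
        { toFun := fun q => (q.1, q.2 + q.1 * a), invFun := fun q => (q.1, q.2 - q.1 * a),
          left_inv := fun q => by ext <;> simp, right_inv := fun q => by ext <;> simp,
          continuous_toFun := by fun_prop, continuous_invFun := by fun_prop }
      have hshear : MeasurePreserving sh (((Measure.addHaar : Measure F)).prod (Measure.addHaar : Measure F)) (((Measure.addHaar : Measure F)).prod (Measure.addHaar : Measure F)) := by
        refine (MeasurePreserving.id (Measure.addHaar : Measure F)).skew_product (g := fun x z => ((x, z + x * a)).2) (by fun_prop)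
          (Eventually.of_forall fun x => ?_)
        simpa [sub_eq_add_neg] using map_add_right_eq_self (Measure.addHaar : Measure F) (x * a)
      have hR : ∫ q, f.toFun ((permGL (Equiv.swap (0 : Fin 3) 1 * Equiv.swap (1 : Fin 3) 2) : GL (Fin 3) F) * (((φ q * ⟨γ₀, hγ₀⟩ : ↥(unipotentRadicalGL F (![false, true, true] : Fin 3 → Bool)))) : GL (Fin 3) F)) ∂(((Measure.addHaar : Measure F)).prod (Measure.addHaar : Measure F)) =
          ∫ q, f.toFun ((permGL (Equiv.swap (0 : Fin 3) 1 * Equiv.swap (1 : Fin 3) 2) : GL (Fin 3) F) * ((φ q : ↥(unipotentRadicalGL F (![false, true, true] : Fin 3 → Bool))) : GL (Fin 3) F)) ∂(((Measure.addHaar : Measure F)).prod (Measure.addHaar : Measure F)) := by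
        have h := integral_mul_right_eq_self (μ := (((Measure.addHaar : Measure F)).prod (Measure.addHaar : Measure F)).map φ) (fun γ : ↥(unipotentRadicalGL F (![false, true, true] : Fin 3 → Bool)) => f.toFun ((permGL (Equiv.swap (0 : Fin 3) 1 * Equiv.swap (1 : Fin 3) 2) : GL (Fin 3) F) * ((γ : ↥(unipotentRadicalGL F (![false, true, true] : Fin 3 → Bool))) : GL (Fin 3) F))) ⟨γ₀, hγ₀⟩
        rwa [hme.integral_map, hme.integral_map] at h
      refine (hshear.integral_comp sh.measurableEmbedding (fun q : F × F => f.toFun ((permGL (Equiv.swap (0 : Fin 3) 1 * Equiv.swap (1 : Fin 3) 2) : GL (Fin 3) F) * (((φ q * ⟨γ₀, hγ₀⟩ : ↥(unipotentRadicalGL F (![false, true, true] : Fin 3 → Bool)))) : GL (Fin 3) F)))).trans ?_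
      exact hR) ew
    (by
      intro m f hf
      have hd0 := blockDiagonalGL_id_three_apply_ne_zero m 0
      have hd1 := blockDiagonalGL_id_three_apply_ne_zero m 1
      have hd2 := blockDiagonalGL_id_three_apply_ne_zero m 2
      have hmemB : (permGL (Equiv.swap (0 : Fin 3) 1 * Equiv.swap (1 : Fin 3) 2) : GL (Fin 3) F) * blockDiagonalGL F (id : Fin 3 → Fin 3) m * (permGL (Equiv.swap (0 : Fin 3) 1 * Equiv.swap (1 : Fin 3) 2) : GL (Fin 3) F)⁻¹ ∈ standardParabolicGL F (id : Fin 3 → Fin 3) := permGL_conj_blockDiagonalGL_mem_borel (Equiv.swap (0 : Fin 3) 1 * Equiv.swap (1 : Fin 3) 2) m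
      have hfun : (fun γ : ↥(unipotentRadicalGL F (![false, true, true] : Fin 3 → Bool)) => (smoothIndRep (standardParabolicGL F (id : Fin 3 → Fin 3)) σ' (blockDiagonalGL F (id : Fin 3 → Fin 3) m) f).toFun ((permGL (Equiv.swap (0 : Fin 3) 1 * Equiv.swap (1 : Fin 3) 2) : GL (Fin 3) F) * ((γ : ↥(unipotentRadicalGL F (![false, true, true] : Fin 3 → Bool))) : GL (Fin 3) F))) =
          fun γ => (((rootDeltaChar (standardParabolicGL F (id : Fin 3 → Fin 3)) ⟨_, hmemB⟩ : ℂˣ) : ℂ) * (((χ (leviProjection F (id : Fin 3 → Fin 3) ⟨_, hmemB⟩)) : ℂˣ) : ℂ)) *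
            f.toFun ((permGL (Equiv.swap (0 : Fin 3) 1 * Equiv.swap (1 : Fin 3) 2) : GL (Fin 3) F) * ((blockDiagonalGL F (id : Fin 3 → Fin 3) m)⁻¹ * ((γ : ↥(unipotentRadicalGL F (![false, true, true] : Fin 3 → Bool))) : GL (Fin 3) F) * blockDiagonalGL F (id : Fin 3 → Fin 3) m)) := by
        funext γ
        rw [toFun_smoothIndRep_apply]
        have hprod : (permGL (Equiv.swap (0 : Fin 3) 1 * Equiv.swap (1 : Fin 3) 2) : GL (Fin 3) F) * ((γ : ↥(unipotentRadicalGL F (![false, true, true] : Fin 3 → Bool))) : GL (Fin 3) F) * blockDiagonalGL F (id : Fin 3 → Fin 3) m = ((permGL (Equiv.swap (0 : Fin 3) 1 * Equiv.swap (1 : Fin 3) 2) : GL (Fin 3) F) * blockDiagonalGL F (id : Fin 3 → Fin 3) m * (permGL (Equiv.swap (0 : Fin 3) 1 * Equiv.swap (1 : Fin 3) 2) : GL (Fin 3) F)⁻¹) * ((permGL (Equiv.swap (0 : Fin 3) 1 * Equiv.swap (1 : Fin 3) 2) : GL (Fin 3) F) * ((blockDiagonalGL F (id : Fin 3 → Fin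 3) m)⁻¹ * ((γ : ↥(unipotentRadicalGL F (![false, true, true] : Fin 3 → Bool))) : GL (Fin 3) F) * blockDiagonalGL F (id : Fin 3 → Fin 3) m)) := by group
        rw [hprod]
        refine (SmoothInd.toFun_subgroup_mul f ⟨_, hmemB⟩ _).trans ?_
        rw [inducingChar_apply]
        exact (mul_assoc _ _ _).symm
      rw [hfun, integral_const_mul]
      have hα : (((blockDiagonalGL F (id : Fin 3 → Fin 3) m : GL (Fin 3) F) : Matrix (Fin 3) (Fin 3) F) 1 1 / ((blockDiagonalGL F (id : Fin 3 → Fin 3) m : GL (Fin 3) F) : Matrix (Fin 3) (Fin 3) F) 0 0) ≠ 0 := div_ne_zero hd1 hd0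
      have hβ : (((blockDiagonalGL F (id : Fin 3 → Fin 3) m : GL (Fin 3) F) : Matrix (Fin 3) (Fin 3) F) 2 2 / ((blockDiagonalGL F (id : Fin 3 → Fin 3) m : GL (Fin 3) F) : Matrix (Fin 3) (Fin 3) F) 0 0) ≠ 0 := div_ne_zero hd2 hd0
      have hconj : ∀ q : F × F, (blockDiagonalGL F (id : Fin 3 → Fin 3) m)⁻¹ * ((φ q : ↥(unipotentRadicalGL F (![false, true, true] : Fin 3 → Bool))) : GL (Fin 3) F) * blockDiagonalGL F (id : Fin 3 → Fin 3) m = ((φ ((((blockDiagonalGL F (id : Fin 3 → Fin 3) m : GL (Fin 3) F) : Matrix (Fin 3) (Fin 3) F) 1 1 / ((blockDiagonalGL F (id : Fin 3 → Fin 3) m : GL (Fin 3) F) : Matrix (Fin 3) (Fin 3) F) 0 0) * q.1, (((blockDiagonalGL F (id : Fin 3 → Fin 3) m : GL (Fin 3) F) : Matrix (Fin 3) (Fin 3) F) 2 2 / ((blockDiagonalGL F (id : Fin 3 → Fin 3) m : GL (Fin 3) F) : Matrix (Fin 3) (Fin 3) F) 0 0) * q.2) : ↥(unipotentRadicalGL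 F (![false, true, true] : Fin 3 → Bool))) : GL (Fin 3) F) := by
        intro q
        rw [hφ, hφ, blockDiagonalGL_inv_mul_coord_mul e he m ((q.1, 0), q.2)]
        congr 2
        ext <;> simp <;> ring
      have hsub : ∫ γ, f.toFun ((permGL (Equiv.swap (0 : Fin 3) 1 * Equiv.swap (1 : Fin 3) 2) : GL (Fin 3) F) * ((blockDiagonalGL F (id : Fin 3 → Fin 3) m)⁻¹ * ((γ : ↥(unipotentRadicalGL F (![false, true, true] : Fin 3 → Bool))) : GL (Fin 3) F) * blockDiagonalGL F (id : Fin 3 → Fin 3) m)) ∂((((Measure.addHaar : Measure F)).prod (Measure.addHaar : Measure F)).map φ) =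
          ((normAbs F (((blockDiagonalGL F (id : Fin 3 → Fin 3) m : GL (Fin 3) F) : Matrix (Fin 3) (Fin 3) F) 1 1 / ((blockDiagonalGL F (id : Fin 3 → Fin 3) m : GL (Fin 3) F) : Matrix (Fin 3) (Fin 3) F) 0 0)⁻¹ * normAbs F (((blockDiagonalGL F (id : Fin 3 → Fin 3) m : GL (Fin 3) F) : Matrix (Fin 3) (Fin 3) F) 2 2 / ((blockDiagonalGL F (id : Fin 3 → Fin 3) m : GL (Fin 3) F) : Matrix (Fin 3) (Fin 3) F) 0 0)⁻¹ : ℝ≥0) : ℝ) *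
            ∫ γ, f.toFun ((permGL (Equiv.swap (0 : Fin 3) 1 * Equiv.swap (1 : Fin 3) 2) : GL (Fin 3) F) * ((γ : ↥(unipotentRadicalGL F (![false, true, true] : Fin 3 → Bool))) : GL (Fin 3) F)) ∂((((Measure.addHaar : Measure F)).prod (Measure.addHaar : Measure F)).map φ) := by
        rw [hme.integral_map, hme.integral_map]
        simp_rw [hconj]
        have hmap := map_prodScale (Measure.addHaar : Measure F) hα hβ
        have heq := integral_map_equiv (((Homeomorph.mulLeft₀ _ hα).prodCongr (Homeomorph.mulLeft₀ _ hβ)).toMeasurableEquiv)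
          (fun q : F × F => f.toFun ((permGL (Equiv.swap (0 : Fin 3) 1 * Equiv.swap (1 : Fin 3) 2) : GL (Fin 3) F) * ((φ q : ↥(unipotentRadicalGL F (![false, true, true] : Fin 3 → Bool))) : GL (Fin 3) F))) (μ := ((Measure.addHaar : Measure F)).prod (Measure.addHaar : Measure F))
        rw [Homeomorph.toMeasurableEquiv_coe] at heq
        change ∫ y, f.toFun ((permGL (Equiv.swap (0 : Fin 3) 1 * Equiv.swap (1 : Fin 3) 2) : GL (Fin 3) F) * ((φ y : ↥(unipotentRadicalGL F (![false, true, true] : Fin 3 → Bool))) : GL (Fin 3) F)) ∂((((Measure.addHaar : Measure F)).prod (Measure.addHaar : Measure F)).map (fun q : F × F => ((((blockDiagonalGL F (id : Fin 3 → Fin 3) m : GL (Fin 3) F) : Matrix (Fin 3) (Fin 3) F) 1 1 / ((blockDiagonalGL F (id : Fin 3 → Fin 3) m : GL (Fin 3) F) : Matrix (Fin 3) (Fin 3) F) 0 0) * q.1, (((blockDiagonalGL F (id : Fin 3 → Fin 3) m : GL (Fin 3) F) : Matrix (Fin 3) (Fin 3) F) 2 2 / ((blockDiagonalGL F (id : Fin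 3 → Fin 3) m : GL (Fin 3) F) : Matrix (Fin 3) (Fin 3) F) 0 0) * q.2))) =
          ∫ q, f.toFun ((permGL (Equiv.swap (0 : Fin 3) 1 * Equiv.swap (1 : Fin 3) 2) : GL (Fin 3) F) * ((φ ((((blockDiagonalGL F (id : Fin 3 → Fin 3) m : GL (Fin 3) F) : Matrix (Fin 3) (Fin 3) F) 1 1 / ((blockDiagonalGL F (id : Fin 3 → Fin 3) m : GL (Fin 3) F) : Matrix (Fin 3) (Fin 3) F) 0 0) * q.1, (((blockDiagonalGL F (id : Fin 3 → Fin 3) m : GL (Fin 3) F) : Matrix (Fin 3) (Fin 3) F) 2 2 / ((blockDiagonalGL F (id : Fin 3 → Fin 3) m : GL (Fin 3) F) : Matrix (Fin 3) (Fin 3) F) 0 0) * q.2) : ↥(unipotentRadicalGL F (![false, true, true] : Fin 3 → Bool))) : GL (Fin 3) F)) ∂(((Measure.addHaar : Measure F)).prod (Measure.addHaar : Measure F)) at heq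
        rw [← heq, hmap, integral_smul_measure, ENNReal.coe_toReal, Complex.real_smul]
      rw [hsub]
      have hw0 : (Equiv.swap (0 : Fin 3) 1 * Equiv.swap (1 : Fin 3) 2) 0 = 1 := by decide
      have hw2 : (Equiv.swap (0 : Fin 3) 1 * Equiv.swap (1 : Fin 3) 2) 2 = 0 := by decide
      have hew : ((ew m : ℂˣ) : ℂ) = (((χ (leviProjection F (id : Fin 3 → Fin 3) ⟨_, hmemB⟩)) : ℂˣ) : ℂ) *
          ((rootDeltaChar (standardParabolicGL F (id : Fin 3 → Fin 3)) (leviEmbeddingP F (id : Fin 3 → Fin 3) m) : ℂˣ) : ℂ) := by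
        simp only [ew, MonoidHom.mul_apply, MonoidHom.coe_comp, Function.comp_apply, Units.val_mul]
        rfl
      have hδ1 : ((rootDeltaChar (standardParabolicGL F (id : Fin 3 → Fin 3)) ⟨_, hmemB⟩ : ℂˣ) : ℂ) =
          (((normAbs F (((blockDiagonalGL F (id : Fin 3 → Fin 3) m : GL (Fin 3) F) : Matrix (Fin 3) (Fin 3) F) 1 1) * (normAbs F (((blockDiagonalGL F (id : Fin 3 → Fin 3) m : GL (Fin 3) F) : Matrix (Fin 3) (Fin 3) F) 0 0))⁻¹ : ℝ≥0) : ℝ) : ℂ) := by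
        rw [K2E3GL3BorelModulus.rootDeltaChar_borel_three]
        simp only [permGL_conj_apply, hw0, hw2]
      have hδ2 : ((rootDeltaChar (standardParabolicGL F (id : Fin 3 → Fin 3)) (leviEmbeddingP F (id : Fin 3 → Fin 3) m) : ℂˣ) : ℂ) =
          (((normAbs F (((blockDiagonalGL F (id : Fin 3 → Fin 3) m : GL (Fin 3) F) : Matrix (Fin 3) (Fin 3) F) 0 0) * (normAbs F (((blockDiagonalGL F (id : Fin 3 → Fin 3) m : GL (Fin 3) F) : Matrix (Fin 3) (Fin 3) F) 2 2))⁻¹ : ℝ≥0) : ℝ) : ℂ) := by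
        rw [K2E3GL3BorelModulus.rootDeltaChar_borel_three, coe_leviEmbeddingP]
      have hn0 : normAbs F (((blockDiagonalGL F (id : Fin 3 → Fin 3) m : GL (Fin 3) F) : Matrix (Fin 3) (Fin 3) F) 0 0) ≠ 0 := (map_ne_zero _).2 hd0
      have hn1 : normAbs F (((blockDiagonalGL F (id : Fin 3 → Fin 3) m : GL (Fin 3) F) : Matrix (Fin 3) (Fin 3) F) 1 1) ≠ 0 := (map_ne_zero _).2 hd1
      have hn2 : normAbs F (((blockDiagonalGL F (id : Fin 3 → Fin 3) m : GL (Fin 3) F) : Matrix (Fin 3) (Fin 3) F) 2 2) ≠ 0 := (map_ne_zero _).2 hd2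
      have key : (normAbs F (((blockDiagonalGL F (id : Fin 3 → Fin 3) m : GL (Fin 3) F) : Matrix (Fin 3) (Fin 3) F) 1 1) * (normAbs F (((blockDiagonalGL F (id : Fin 3 → Fin 3) m : GL (Fin 3) F) : Matrix (Fin 3) (Fin 3) F) 0 0))⁻¹ : ℝ≥0) *
          (normAbs F (((blockDiagonalGL F (id : Fin 3 → Fin 3) m : GL (Fin 3) F) : Matrix (Fin 3) (Fin 3) F) 1 1 / ((blockDiagonalGL F (id : Fin 3 → Fin 3) m : GL (Fin 3) F) : Matrix (Fin 3) (Fin 3) F) 0 0)⁻¹ * normAbs F (((blockDiagonalGL F (id : Fin 3 → Fin 3) m : GL (Fin 3) F) : Matrix (Fin 3) (Fin 3) F) 2 2 / ((blockDiagonalGL F (id : Fin 3 → Fin 3) m : GL (Fin 3) F) : Matrix (Fin 3) (Fin 3) F) 0 0)⁻¹) = normAbs F (((blockDiagonalGL F (id : Fin 3 → Fin 3) m : GL (Fin 3) F) : Matrix (Fin 3) (Fin 3) F) 0 0) * (normAbs F (((blockDiagonalGL F (id : Fin 3 → Fin 3) m : GL (Fin 3) F) : Matrix (Fin 3) (Fin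 3) F) 2 2))⁻¹ := by
        rw [inv_div, inv_div, map_div₀, map_div₀]
        field_simp
      rw [hew, hδ1, hδ2, ← key]
      push_cast
      ring)
  refine ⟨Λ, hker, hne, fun m x hx => ?_⟩
  rw [hequiv m x hx]
  congr 2
  have hew' : ew * ((rootDeltaChar (standardParabolicGL F (id : Fin 3 → Fin 3))).comp (leviEmbeddingP F (id : Fin 3 → Fin 3)))⁻¹ =
      χ.comp ((leviProjection F (id : Fin 3 → Fin 3)).comp conjB) := by
    ext n
    simp only [ew, MonoidHom.mul_apply, MonoidHom.inv_apply, MonoidHom.coe_comp, Function.comp_apply, mul_inv_cancel_right]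
  rw [hew']
  rfl

/-! ## §3 Cell `s₂s₁ = (0→2→1→0)`: `Γ = U_Q ≅ F × F` (normal in `U`), `S = U_{α₁}` -/

set_option maxHeartbeats 400000 in
/-- **Cell `cycle_two_zero_one` contributes exactly a line to `r_U(Ind_B χδ^{1/2})`, with exponent `χ ∘ Ad(P_w)`** (★ E3γ2 with the cell datum of ★ E3β₁; `Γ` is normal in `U`, the Haar measure
`μ_F ⊗ μ_F` transported to `Γ` is invariant under the shears `γ ↦ s⁻¹γs` (`s ∈ S`), which gives `hinv`; `hT` by a diagonal scaling whose module is
`δ^{1/2}(diag)/δ^{1/2}(P diag P⁻¹)` (★ `rootDeltaChar_borel_three`)). [cite: BernsteinZelevinsky1977, Thm. 5.2] [cite: Casselman1995, §6.3, Thm. 6.3.5] -/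
theorem exists_lineFunctional_cell_cycle_two_zero_one (χ : (Π a : Fin 3, GL {i : Fin 3 // (id : Fin 3 → Fin 3) i = a} F) →* ℂˣ) (hχ : IsOpen (χ.ker : Set (Π a : Fin 3, GL {i : Fin 3 // (id : Fin 3 → Fin 3) i = a} F))) :
    let σ' := Representation.twist (((Representation.trivial ℂ (Π a : Fin 3, GL {i : Fin 3 // (id : Fin 3 → Fin 3) i = a} F) ℂ).twist χ).comp (leviProjection F (id : Fin 3 → Fin 3))) (rootDeltaChar (standardParabolicGL F (id : Fin 3 → Fin 3)))
    let I := smoothIndRep (standardParabolicGL F (id : Fin 3 → Fin 3)) σ'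
    let mk := Coinvariants.mk (restrictUnipotentGL F (id : Fin 3 → Fin 3) I)
    let Flt := (vanishingOn (standardParabolicGL F (id : Fin 3 → Fin 3)) σ' (cellLT (K := F) (id : Fin 3 → Fin 3) (Equiv.swap (1 : Fin 3) 2 * Equiv.swap (0 : Fin 3) 1))).map mk
    let Fle := (vanishingOn (standardParabolicGL F (id : Fin 3 → Fin 3)) σ' (cellLE (K := F) (id : Fin 3 → Fin 3) (Equiv.swap (1 : Fin 3) 2 * Equiv.swap (0 : Fin 3) 1))).map mk
    ∃ Λ : (restrictUnipotentGL F (id : Fin 3 → Fin 3) I).Coinvariants →ₗ[ℂ] ℂ,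
      (∀ x ∈ Flt, Λ x = 0 ↔ x ∈ Fle) ∧ (∃ x ∈ Flt, Λ x ≠ 0) ∧
      ∀ (m : (Π a : Fin 3, GL {i : Fin 3 // (id : Fin 3 → Fin 3) i = a} F)), ∀ x ∈ Flt,
        Λ (Representation.normalizedJacquetGL F (id : Fin 3 → Fin 3) I m x) =
          ((χ (leviProjection F (id : Fin 3 → Fin 3) ⟨(permGL (Equiv.swap (1 : Fin 3) 2 * Equiv.swap (0 : Fin 3) 1) : GL (Fin 3) F) * blockDiagonalGL F (id : Fin 3 → Fin 3) m * (permGL (Equiv.swap (1 : Fin 3) 2 * Equiv.swap (0 : Fin 3) 1) : GL (Fin 3) F)⁻¹, permGL_conj_blockDiagonalGL_mem_borel (Equiv.swap (1 : Fin 3) 2 * Equiv.swap (0 : Fin 3) 1) m⟩) : ℂˣ) : ℂ) * Λ x := by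
  intro σ' I mk Flt Fle
  haveI : T2Space F := (isLocalField F).toT2Space
  haveI : LocallyCompactSpace F := (isLocalField F).toLocallyCompactSpace
  haveI : SecondCountableTopology F := secondCountableTopology_localField F
  letI : MeasurableSpace F := borel F
  haveI : BorelSpace F := ⟨rfl⟩
  -- the cell datum (★ E3β₁) and the retraction (★ E3β₂)
  obtain ⟨hΓlow, hS, hSB, hdec⟩ := cellDatum_cycle_two_zero_one (F := F)
  have hΓU : unipotentRadicalGL F (![false, false, true] : Fin 3 → Bool) ≤ upperUnitriangular (Fin 3) F := (rootSubgroups_le (F := F)).1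
  have hSU : unipotentRadicalGL F (![false, true, true] : Fin 3 → Bool) ⊓ standardLeviGL F (![false, false, true] : Fin 3 → Bool) ≤ upperUnitriangular (Fin 3) F := (rootSubgroups_le (F := F)).2.2.1
  have hΓcl : IsClosed ((unipotentRadicalGL F (![false, false, true] : Fin 3 → Bool) : Subgroup (GL (Fin 3) F)) : Set (GL (Fin 3) F)) := isClosed_unipotentRadicalGL _
  have hΓlim : IsLimitOfCompactOpen ↥(unipotentRadicalGL F (![false, false, true] : Fin 3 → Bool)) := (isLimitOfCompactOpen_upperUnitriangular F 3).of_le hΓU hΓcl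
  obtain ⟨proj, hproj, hprojS⟩ := exists_proj_cycle_two_zero_one (F := F)
  -- coordinates (★ p11) and the transported Haar measure `μ_F ⊗ μ_F` on `Γ` (★ E3β₂)
  obtain ⟨e, he⟩ := exists_coordHomeomorph (R := F)
  obtain ⟨φ, hφ, hφadd⟩ := exists_homeomorph_unipotentRadicalGL_twoOne e he
  letI : MeasurableSpace ↥(unipotentRadicalGL F (![false, false, true] : Fin 3 → Bool)) := borel _
  haveI : BorelSpace ↥(unipotentRadicalGL F (![false, false, true] : Fin 3 → Bool)) := ⟨rfl⟩
  obtain ⟨i1, i2, i3⟩ := measure_map_addHomeomorph φ hφadd (((Measure.addHaar : Measure F)).prod (Measure.addHaar : Measure F))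
  haveI := i1; haveI := i2; haveI := i3
  have hme : MeasurableEmbedding φ := φ.measurableEmbedding
  -- the torus character `e_w = (χ ∘ levi ∘ Ad P_w ∘ diag) · (δ^{1/2} ∘ diag)`
  let conjB : (Π a : Fin 3, GL {i : Fin 3 // (id : Fin 3 → Fin 3) i = a} F) →* ↥(standardParabolicGL F (id : Fin 3 → Fin 3)) :=
    ((MulAut.conj (permGL (Equiv.swap (1 : Fin 3) 2 * Equiv.swap (0 : Fin 3) 1) : GL (Fin 3) F)).toMonoidHom.comp (blockDiagonalGL F (id : Fin 3 → Fin 3))).codRestrict (standardParabolicGL F (id : Fin 3 → Fin 3))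
      (fun m => permGL_conj_blockDiagonalGL_mem_borel (Equiv.swap (1 : Fin 3) 2 * Equiv.swap (0 : Fin 3) 1) m)
  let ew : (Π a : Fin 3, GL {i : Fin 3 // (id : Fin 3 → Fin 3) i = a} F) →* ℂˣ := (χ.comp ((leviProjection F (id : Fin 3 → Fin 3)).comp conjB)) *
    (rootDeltaChar (standardParabolicGL F (id : Fin 3 → Fin 3))).comp (leviEmbeddingP F (id : Fin 3 → Fin 3))
  obtain ⟨Λ, hker, hne, hequiv⟩ := exists_lineFunctional_of_cellDatum σ' (Equiv.swap (1 : Fin 3) 2 * Equiv.swap (0 : Fin 3) 1) (unipotentRadicalGL F (![false, false, true] : Fin 3 → Bool)) (unipotentRadicalGL F (![false, true, true] : Fin 3 → Bool) ⊓ standardLeviGL F (![false, false, true] : Fin 3 → Bool)) (isSmooth_inducingChar χ hχ)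
    hΓU hΓcl hΓlim hΓlow hS hSB hdec proj hproj hprojS ((((Measure.addHaar : Measure F)).prod (Measure.addHaar : Measure F)).map φ)
    (by
      intro u hu f hf
      obtain ⟨s₀, hs₀, γ₀, hγ₀, rfl⟩ := hdec u hu
      -- `s₀` in coordinates
      obtain ⟨-, hz1, hz2⟩ := (mem_rootGroup_zeroOne_iff s₀).1 hs₀
      set a : F := (s₀ : Matrix (Fin 3) (Fin 3) F) 0 1 with ha
      have hs₀c : s₀ = ((e ((a, 0), 0) : ↥(unipotentRadicalGL F (id : Fin 3 → Fin 3))) : GL (Fin 3) F) := by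
        conv_lhs => rw [eq_coord e he s₀ (hSU hs₀)]
        rw [hz1, hz2]
      have hB' := hSB _ hs₀
      have hU' : (permGL (Equiv.swap (1 : Fin 3) 2 * Equiv.swap (0 : Fin 3) 1) : GL (Fin 3) F) * s₀ * (permGL (Equiv.swap (1 : Fin 3) 2 * Equiv.swap (0 : Fin 3) 1) : GL (Fin 3) F)⁻¹ ∈ upperUnitriangular (Fin 3) F := permGL_conj_mem_upperUnitriangular _ (hSU hs₀) hB'
      have hfun : (fun γ : ↥(unipotentRadicalGL F (![false, false, true] : Fin 3 → Bool)) => (smoothIndRep (standardParabolicGL F (id : Fin 3 → Fin 3)) σ' (s₀ * γ₀) f).toFun ((permGL (Equiv.swap (1 : Fin 3) 2 * Equiv.swap (0 : Fin 3) 1) : GL (Fin 3) F) * ((γ : ↥(unipotentRadicalGL F (![false, false, true] : Fin 3 → Bool))) : GL (Fin 3) F))) =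
          fun γ => f.toFun ((permGL (Equiv.swap (1 : Fin 3) 2 * Equiv.swap (0 : Fin 3) 1) : GL (Fin 3) F) * ((s₀⁻¹ * ((γ : ↥(unipotentRadicalGL F (![false, false, true] : Fin 3 → Bool))) : GL (Fin 3) F) * s₀) * γ₀)) := by
        funext γ
        rw [toFun_smoothIndRep_apply]
        have hprod : (permGL (Equiv.swap (1 : Fin 3) 2 * Equiv.swap (0 : Fin 3) 1) : GL (Fin 3) F) * ((γ : ↥(unipotentRadicalGL F (![false, false, true] : Fin 3 → Bool))) : GL (Fin 3) F) * (s₀ * γ₀) = ((permGL (Equiv.swap (1 : Fin 3) 2 * Equiv.swap (0 : Fin 3) 1) : GL (Fin 3) F) * s₀ * (permGL (Equiv.swap (1 : Fin 3) 2 * Equiv.swap (0 : Fin 3) 1) : GL (Fin 3) F)⁻¹) * ((permGL (Equiv.swap (1 : Fin 3) 2 * Equiv.swap (0 : Fin 3) 1) : GL (Fin 3) F) * ((s₀⁻¹ * ((γ : ↥(unipotentRadicalGL F (![false, false, true] : Fin 3 → Bool))) : GL (Fin 3) F) * s₀) * γ₀)) := by group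
        rw [hprod]
        refine (SmoothInd.toFun_subgroup_mul f ⟨_, unipotentRadicalGL_le F (id : Fin 3 → Fin 3) hU'⟩ _).trans ?_
        exact inducingChar_apply_of_mem_upperUnitriangular χ hU' _
      rw [hfun, hme.integral_map, hme.integral_map]
      -- the shear `q ↦ φ⁻¹(s₀⁻¹ φ(q) s₀)` preserves `μ_F ⊗ μ_F`
      have hconj : ∀ q : F × F, s₀⁻¹ * ((φ q : ↥(unipotentRadicalGL F (![false, false, true] : Fin 3 → Bool))) : GL (Fin 3) F) * s₀ = ((φ ((q.1, q.2 - a * q.1)) : ↥(unipotentRadicalGL F (![false, false, true] : Fin 3 → Bool))) : GL (Fin 3) F) := by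
        intro q
        rw [hφ, hφ, hs₀c, rootGroup_zeroOne_inv_mul_coord_mul e he]
      simp_rw [hconj]
      let sh : F × F ≃ₜ F × F :=
        { toFun := fun q => (q.1, q.2 - a * q.1), invFun := fun q => (q.1, q.2 + a * q.1),
          left_inv := fun q => by ext <;> simp, right_inv := fun q => by ext <;> simp,
          continuous_toFun := by fun_prop, continuous_invFun := by fun_prop }
      have hshear : MeasurePreserving sh (((Measure.addHaar : Measure F)).prod (Measure.addHaar : Measure F)) (((Measure.addHaar : Measure F)).prod (Measure.addHaar : Measure F)) := by
        refine (MeasurePreserving.id (Measure.addHaar : Measure F)).skew_product (g := fun x z => ((x, z - a * x)).2) (by fun_prop)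
          (Eventually.of_forall fun x => ?_)
        simpa [sub_eq_add_neg] using map_add_right_eq_self (Measure.addHaar : Measure F) (-(a * x))
      have hR : ∫ q, f.toFun ((permGL (Equiv.swap (1 : Fin 3) 2 * Equiv.swap (0 : Fin 3) 1) : GL (Fin 3) F) * (((φ q * ⟨γ₀, hγ₀⟩ : ↥(unipotentRadicalGL F (![false, false, true] : Fin 3 → Bool)))) : GL (Fin 3) F)) ∂(((Measure.addHaar : Measure F)).prod (Measure.addHaar : Measure F)) =
          ∫ q, f.toFun ((permGL (Equiv.swap (1 : Fin 3) 2 * Equiv.swap (0 : Fin 3) 1) : GL (Fin 3) F) * ((φ q : ↥(unipotentRadicalGL F (![false, false, true] : Fin 3 → Bool))) : GL (Fin 3) F)) ∂(((Measure.addHaar : Measure F)).prod (Measure.addHaar : Measure F)) := by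
        have h := integral_mul_right_eq_self (μ := (((Measure.addHaar : Measure F)).prod (Measure.addHaar : Measure F)).map φ) (fun γ : ↥(unipotentRadicalGL F (![false, false, true] : Fin 3 → Bool)) => f.toFun ((permGL (Equiv.swap (1 : Fin 3) 2 * Equiv.swap (0 : Fin 3) 1) : GL (Fin 3) F) * ((γ : ↥(unipotentRadicalGL F (![false, false, true] : Fin 3 → Bool))) : GL (Fin 3) F))) ⟨γ₀, hγ₀⟩
        rwa [hme.integral_map, hme.integral_map] at h
      refine (hshear.integral_comp sh.measurableEmbedding (fun q : F × F => f.toFun ((permGL (Equiv.swap (1 : Fin 3) 2 * Equiv.swap (0 : Fin 3) 1) : GL (Fin 3) F) * (((φ q * ⟨γ₀, hγ₀⟩ : ↥(unipotentRadicalGL F (![false, false, true] : Fin 3 → Bool)))) : GL (Fin 3) F)))).trans ?_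
      exact hR) ew
    (by
      intro m f hf
      have hd0 := blockDiagonalGL_id_three_apply_ne_zero m 0
      have hd1 := blockDiagonalGL_id_three_apply_ne_zero m 1
      have hd2 := blockDiagonalGL_id_three_apply_ne_zero m 2
      have hmemB : (permGL (Equiv.swap (1 : Fin 3) 2 * Equiv.swap (0 : Fin 3) 1) : GL (Fin 3) F) * blockDiagonalGL F (id : Fin 3 → Fin 3) m * (permGL (Equiv.swap (1 : Fin 3) 2 * Equiv.swap (0 : Fin 3) 1) : GL (Fin 3) F)⁻¹ ∈ standardParabolicGL F (id : Fin 3 → Fin 3) := permGL_conj_blockDiagonalGL_mem_borel (Equiv.swap (1 : Fin 3) 2 * Equiv.swap (0 : Fin 3) 1) m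
      have hfun : (fun γ : ↥(unipotentRadicalGL F (![false, false, true] : Fin 3 → Bool)) => (smoothIndRep (standardParabolicGL F (id : Fin 3 → Fin 3)) σ' (blockDiagonalGL F (id : Fin 3 → Fin 3) m) f).toFun ((permGL (Equiv.swap (1 : Fin 3) 2 * Equiv.swap (0 : Fin 3) 1) : GL (Fin 3) F) * ((γ : ↥(unipotentRadicalGL F (![false, false, true] : Fin 3 → Bool))) : GL (Fin 3) F))) =
          fun γ => (((rootDeltaChar (standardParabolicGL F (id : Fin 3 → Fin 3)) ⟨_, hmemB⟩ : ℂˣ) : ℂ) * (((χ (leviProjection F (id : Fin 3 → Fin 3) ⟨_, hmemB⟩)) : ℂˣ) : ℂ)) *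
            f.toFun ((permGL (Equiv.swap (1 : Fin 3) 2 * Equiv.swap (0 : Fin 3) 1) : GL (Fin 3) F) * ((blockDiagonalGL F (id : Fin 3 → Fin 3) m)⁻¹ * ((γ : ↥(unipotentRadicalGL F (![false, false, true] : Fin 3 → Bool))) : GL (Fin 3) F) * blockDiagonalGL F (id : Fin 3 → Fin 3) m)) := by
        funext γ
        rw [toFun_smoothIndRep_apply]
        have hprod : (permGL (Equiv.swap (1 : Fin 3) 2 * Equiv.swap (0 : Fin 3) 1) : GL (Fin 3) F) * ((γ : ↥(unipotentRadicalGL F (![false, false, true] : Fin 3 → Bool))) : GL (Fin 3) F) * blockDiagonalGL F (id : Fin 3 → Fin 3) m = ((permGL (Equiv.swap (1 : Fin 3) 2 * Equiv.swap (0 : Fin 3) 1) : GL (Fin 3) F) * blockDiagonalGL F (id : Fin 3 → Fin 3) m * (permGL (Equiv.swap (1 : Fin 3) 2 * Equiv.swap (0 : Fin 3) 1) : GL (Fin 3) F)⁻¹) * ((permGL (Equiv.swap (1 : Fin 3) 2 * Equiv.swap (0 : Fin 3) 1) : GL (Fin 3) F) * ((blockDiagonalGL F (id : Fin 3 → Fin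 3) m)⁻¹ * ((γ : ↥(unipotentRadicalGL F (![false, false, true] : Fin 3 → Bool))) : GL (Fin 3) F) * blockDiagonalGL F (id : Fin 3 → Fin 3) m)) := by group
        rw [hprod]
        refine (SmoothInd.toFun_subgroup_mul f ⟨_, hmemB⟩ _).trans ?_
        rw [inducingChar_apply]
        exact (mul_assoc _ _ _).symm
      rw [hfun, integral_const_mul]
      have hα : (((blockDiagonalGL F (id : Fin 3 → Fin 3) m : GL (Fin 3) F) : Matrix (Fin 3) (Fin 3) F) 2 2 / ((blockDiagonalGL F (id : Fin 3 → Fin 3) m : GL (Fin 3) F) : Matrix (Fin 3) (Fin 3) F) 1 1) ≠ 0 := div_ne_zero hd2 hd1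
      have hβ : (((blockDiagonalGL F (id : Fin 3 → Fin 3) m : GL (Fin 3) F) : Matrix (Fin 3) (Fin 3) F) 2 2 / ((blockDiagonalGL F (id : Fin 3 → Fin 3) m : GL (Fin 3) F) : Matrix (Fin 3) (Fin 3) F) 0 0) ≠ 0 := div_ne_zero hd2 hd0
      have hconj : ∀ q : F × F, (blockDiagonalGL F (id : Fin 3 → Fin 3) m)⁻¹ * ((φ q : ↥(unipotentRadicalGL F (![false, false, true] : Fin 3 → Bool))) : GL (Fin 3) F) * blockDiagonalGL F (id : Fin 3 → Fin 3) m = ((φ ((((blockDiagonalGL F (id : Fin 3 → Fin 3) m : GL (Fin 3) F) : Matrix (Fin 3) (Fin 3) F) 2 2 / ((blockDiagonalGL F (id : Fin 3 → Fin 3) m : GL (Fin 3) F) : Matrix (Fin 3) (Fin 3) F) 1 1) * q.1, (((blockDiagonalGL F (id : Fin 3 → Fin 3) m : GL (Fin 3) F) : Matrix (Fin 3) (Fin 3) F) 2 2 / ((blockDiagonalGL F (id : Fin 3 → Fin 3) m : GL (Fin 3) F) : Matrix (Fin 3) (Fin 3) F) 0 0) * q.2) : ↥(unipotentRadicalGL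 F (![false, false, true] : Fin 3 → Bool))) : GL (Fin 3) F) := by
        intro q
        rw [hφ, hφ, blockDiagonalGL_inv_mul_coord_mul e he m ((0, q.1), q.2)]
        congr 2
        ext <;> simp <;> ring
      have hsub : ∫ γ, f.toFun ((permGL (Equiv.swap (1 : Fin 3) 2 * Equiv.swap (0 : Fin 3) 1) : GL (Fin 3) F) * ((blockDiagonalGL F (id : Fin 3 → Fin 3) m)⁻¹ * ((γ : ↥(unipotentRadicalGL F (![false, false, true] : Fin 3 → Bool))) : GL (Fin 3) F) * blockDiagonalGL F (id : Fin 3 → Fin 3) m)) ∂((((Measure.addHaar : Measure F)).prod (Measure.addHaar : Measure F)).map φ) =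
          ((normAbs F (((blockDiagonalGL F (id : Fin 3 → Fin 3) m : GL (Fin 3) F) : Matrix (Fin 3) (Fin 3) F) 2 2 / ((blockDiagonalGL F (id : Fin 3 → Fin 3) m : GL (Fin 3) F) : Matrix (Fin 3) (Fin 3) F) 1 1)⁻¹ * normAbs F (((blockDiagonalGL F (id : Fin 3 → Fin 3) m : GL (Fin 3) F) : Matrix (Fin 3) (Fin 3) F) 2 2 / ((blockDiagonalGL F (id : Fin 3 → Fin 3) m : GL (Fin 3) F) : Matrix (Fin 3) (Fin 3) F) 0 0)⁻¹ : ℝ≥0) : ℝ) *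
            ∫ γ, f.toFun ((permGL (Equiv.swap (1 : Fin 3) 2 * Equiv.swap (0 : Fin 3) 1) : GL (Fin 3) F) * ((γ : ↥(unipotentRadicalGL F (![false, false, true] : Fin 3 → Bool))) : GL (Fin 3) F)) ∂((((Measure.addHaar : Measure F)).prod (Measure.addHaar : Measure F)).map φ) := by
        rw [hme.integral_map, hme.integral_map]
        simp_rw [hconj]
        have hmap := map_prodScale (Measure.addHaar : Measure F) hα hβ
        have heq := integral_map_equiv (((Homeomorph.mulLeft₀ _ hα).prodCongr (Homeomorph.mulLeft₀ _ hβ)).toMeasurableEquiv)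
          (fun q : F × F => f.toFun ((permGL (Equiv.swap (1 : Fin 3) 2 * Equiv.swap (0 : Fin 3) 1) : GL (Fin 3) F) * ((φ q : ↥(unipotentRadicalGL F (![false, false, true] : Fin 3 → Bool))) : GL (Fin 3) F))) (μ := ((Measure.addHaar : Measure F)).prod (Measure.addHaar : Measure F))
        rw [Homeomorph.toMeasurableEquiv_coe] at heq
        change ∫ y, f.toFun ((permGL (Equiv.swap (1 : Fin 3) 2 * Equiv.swap (0 : Fin 3) 1) : GL (Fin 3) F) * ((φ y : ↥(unipotentRadicalGL F (![false, false, true] : Fin 3 → Bool))) : GL (Fin 3) F)) ∂((((Measure.addHaar : Measure F)).prod (Measure.addHaar : Measure F)).map (fun q : F × F => ((((blockDiagonalGL F (id : Fin 3 → Fin 3) m : GL (Fin 3) F) : Matrix (Fin 3) (Fin 3) F) 2 2 / ((blockDiagonalGL F (id : Fin 3 → Fin 3) m : GL (Fin 3) F) : Matrix (Fin 3) (Fin 3) F) 1 1) * q.1, (((blockDiagonalGL F (id : Fin 3 → Fin 3) m : GL (Fin 3) F) : Matrix (Fin 3) (Fin 3) F) 2 2 / ((blockDiagonalGL F (id : Fin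 3 → Fin 3) m : GL (Fin 3) F) : Matrix (Fin 3) (Fin 3) F) 0 0) * q.2))) =
          ∫ q, f.toFun ((permGL (Equiv.swap (1 : Fin 3) 2 * Equiv.swap (0 : Fin 3) 1) : GL (Fin 3) F) * ((φ ((((blockDiagonalGL F (id : Fin 3 → Fin 3) m : GL (Fin 3) F) : Matrix (Fin 3) (Fin 3) F) 2 2 / ((blockDiagonalGL F (id : Fin 3 → Fin 3) m : GL (Fin 3) F) : Matrix (Fin 3) (Fin 3) F) 1 1) * q.1, (((blockDiagonalGL F (id : Fin 3 → Fin 3) m : GL (Fin 3) F) : Matrix (Fin 3) (Fin 3) F) 2 2 / ((blockDiagonalGL F (id : Fin 3 → Fin 3) m : GL (Fin 3) F) : Matrix (Fin 3) (Fin 3) F) 0 0) * q.2) : ↥(unipotentRadicalGL F (![false, false, true] : Fin 3 → Bool))) : GL (Fin 3) F)) ∂(((Measure.addHaar : Measure F)).prod (Measure.addHaar : Measure F)) at heq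
        rw [← heq, hmap, integral_smul_measure, ENNReal.coe_toReal, Complex.real_smul]
      rw [hsub]
      have hw0 : (Equiv.swap (1 : Fin 3) 2 * Equiv.swap (0 : Fin 3) 1) 0 = 2 := by decide
      have hw2 : (Equiv.swap (1 : Fin 3) 2 * Equiv.swap (0 : Fin 3) 1) 2 = 1 := by decide
      have hew : ((ew m : ℂˣ) : ℂ) = (((χ (leviProjection F (id : Fin 3 → Fin 3) ⟨_, hmemB⟩)) : ℂˣ) : ℂ) *
          ((rootDeltaChar (standardParabolicGL F (id : Fin 3 → Fin 3)) (leviEmbeddingP F (id : Fin 3 → Fin 3) m) : ℂˣ) : ℂ) := by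
        simp only [ew, MonoidHom.mul_apply, MonoidHom.coe_comp, Function.comp_apply, Units.val_mul]
        rfl
      have hδ1 : ((rootDeltaChar (standardParabolicGL F (id : Fin 3 → Fin 3)) ⟨_, hmemB⟩ : ℂˣ) : ℂ) =
          (((normAbs F (((blockDiagonalGL F (id : Fin 3 → Fin 3) m : GL (Fin 3) F) : Matrix (Fin 3) (Fin 3) F) 2 2) * (normAbs F (((blockDiagonalGL F (id : Fin 3 → Fin 3) m : GL (Fin 3) F) : Matrix (Fin 3) (Fin 3) F) 1 1))⁻¹ : ℝ≥0) : ℝ) : ℂ) := by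
        rw [K2E3GL3BorelModulus.rootDeltaChar_borel_three]
        simp only [permGL_conj_apply, hw0, hw2]
      have hδ2 : ((rootDeltaChar (standardParabolicGL F (id : Fin 3 → Fin 3)) (leviEmbeddingP F (id : Fin 3 → Fin 3) m) : ℂˣ) : ℂ) =
          (((normAbs F (((blockDiagonalGL F (id : Fin 3 → Fin 3) m : GL (Fin 3) F) : Matrix (Fin 3) (Fin 3) F) 0 0) * (normAbs F (((blockDiagonalGL F (id : Fin 3 → Fin 3) m : GL (Fin 3) F) : Matrix (Fin 3) (Fin 3) F) 2 2))⁻¹ : ℝ≥0) : ℝ) : ℂ) := by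
        rw [K2E3GL3BorelModulus.rootDeltaChar_borel_three, coe_leviEmbeddingP]
      have hn0 : normAbs F (((blockDiagonalGL F (id : Fin 3 → Fin 3) m : GL (Fin 3) F) : Matrix (Fin 3) (Fin 3) F) 0 0) ≠ 0 := (map_ne_zero _).2 hd0
      have hn1 : normAbs F (((blockDiagonalGL F (id : Fin 3 → Fin 3) m : GL (Fin 3) F) : Matrix (Fin 3) (Fin 3) F) 1 1) ≠ 0 := (map_ne_zero _).2 hd1
      have hn2 : normAbs F (((blockDiagonalGL F (id : Fin 3 → Fin 3) m : GL (Fin 3) F) : Matrix (Fin 3) (Fin 3) F) 2 2) ≠ 0 := (map_ne_zero _).2 hd2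
      have key : (normAbs F (((blockDiagonalGL F (id : Fin 3 → Fin 3) m : GL (Fin 3) F) : Matrix (Fin 3) (Fin 3) F) 2 2) * (normAbs F (((blockDiagonalGL F (id : Fin 3 → Fin 3) m : GL (Fin 3) F) : Matrix (Fin 3) (Fin 3) F) 1 1))⁻¹ : ℝ≥0) *
          (normAbs F (((blockDiagonalGL F (id : Fin 3 → Fin 3) m : GL (Fin 3) F) : Matrix (Fin 3) (Fin 3) F) 2 2 / ((blockDiagonalGL F (id : Fin 3 → Fin 3) m : GL (Fin 3) F) : Matrix (Fin 3) (Fin 3) F) 1 1)⁻¹ * normAbs F (((blockDiagonalGL F (id : Fin 3 → Fin 3) m : GL (Fin 3) F) : Matrix (Fin 3) (Fin 3) F) 2 2 / ((blockDiagonalGL F (id : Fin 3 → Fin 3) m : GL (Fin 3) F) : Matrix (Fin 3) (Fin 3) F) 0 0)⁻¹) = normAbs F (((blockDiagonalGL F (id : Fin 3 → Fin 3) m : GL (Fin 3) F) : Matrix (Fin 3) (Fin 3) F) 0 0) * (normAbs F (((blockDiagonalGL F (id : Fin 3 → Fin 3) m : GL (Fin 3) F) : Matrix (Fin 3) (Fin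 3) F) 2 2))⁻¹ := by
        rw [inv_div, inv_div, map_div₀, map_div₀]
        field_simp
      rw [hew, hδ1, hδ2, ← key]
      push_cast
      ring)
  refine ⟨Λ, hker, hne, fun m x hx => ?_⟩
  rw [hequiv m x hx]
  congr 2
  have hew' : ew * ((rootDeltaChar (standardParabolicGL F (id : Fin 3 → Fin 3))).comp (leviEmbeddingP F (id : Fin 3 → Fin 3)))⁻¹ =
      χ.comp ((leviProjection F (id : Fin 3 → Fin 3)).comp conjB) := by
    ext n
    simp only [ew, MonoidHom.mul_apply, MonoidHom.inv_apply, MonoidHom.coe_comp, Function.comp_apply, mul_inv_cancel_right]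
  rw [hew']
  rfl

end Summit.HodgeConjecture.HodgeConjecture.Cruxes.H413.K2E3GL3BruhatCellFunctionalsCycles
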